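import Literature.MathematicalPhysics.QuantumLattice.FinDimSpectrumSectorGibbsLimit
import HarnessLib

/-!
# Crux `NoInfraredPileUp` (stmt-HubbardSuperconductivity-18534, route `InfiniteVolumeFirst`) —
# Feynman–Onsager / Pitaevskii–Stringari from an ENERGY FLOOR (first lemma of the crux idea
# `phonon-equipartition-compressibility`)

Finite-dimensional, Hamiltonian-free linear algebra. Let `H`, `V` be Hermitian matrices leaving a
subspace (sector) `K` invariant, `ψ ∈ K` a unit eigenvector of `H` at the sector energy
`E₀ = minEnergyOn H K`, with `⟨ψ, Vψ⟩ = 0` and `⟨Vψ, V²ψ⟩ = 0` (both automatic for a momentum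
eigenstate and a density wave `V = ρ(q) + ρ(q)ᴴ` at `3q ≠ 0`). If the perturbed sector energy has the
QUADRATIC FLOOR `minEnergyOn (H + hV) K ≥ E₀ - C h²` for `|h| ≤ h₀` (a bounded static
susceptibility in the channel `V`), then the fluctuation of `V` in `ψ` is controlled by its
`f`-sum (double-commutator) moment:

  `⟨Vψ, Vψ⟩² ≤ C · Re⟨Vψ, (H - E₀) Vψ⟩`   (`m₀² ≤ χ · m₁`).

Proof (Feynman 1954; Pitaevskii–Stringari 1991, the variational half of `m₀² ≤ m₁ m₋₁`): the trial
vectors `ψ - s h • Vψ ∈ K` have Rayleigh quotient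
`E₀ + h² (s² m₁ - 2 s m₀) / (1 + s² h² m₀)` for `H + hV` (the cross terms vanish by the two
orthogonality hypotheses and the eigen-equation); the floor gives `2 s m₀ - s² m₁ ≤ C (1 + s²h²m₀)`
for every `s` and every `h ∈ (0, h₀]`, hence `2 s m₀ - s² m₁ ≤ C` (`h → 0`), and `s := m₀/m₁`
(or `m₀ = 0` when `m₁ = 0`) gives the claim; `m₁ ≥ 0` is the variational principle for `Vψ ∈ K`.

This is the typed FIRST LEMMA `fluct_sq_le_floor_mul_fsum` of
`Cruxes/NoInfraredPileUp/SketchIdeator1.lean` §B (crux idea `phonon-equipartition-compressibility`,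
planner-cruxidea-stmt-HubbardSuperconductivity-18534-1-0), signature verbatim, registered on the crux
item as stub `stub_fluctSqLeFloorMulFsum`. In the idea it converts hypothesis B1 (bounded
long-wavelength density susceptibility, an energy-floor statement) into a bound on density
fluctuations by the `f`-sum, the first step of the compressibility route to `NoSymmetricPileUp`.

Sources: R. P. Feynman, Phys. Rev. 94 (1954) 262; L. Pitaevskii, S. Stringari, J. Low Temp. Phys.
85 (1991) 377 (moment inequalities `m₀² ≤ m₁ m₋₁`); H. Tasaki, *Physics and Mathematics of Quantum
Many-Body Systems* (2020) §2.2 (sector energies, variational principle). Folklore finite-dimensional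
statement; no definition and no named fact is introduced. Tree: `Matrix.minEnergyOn`,
`minEnergyOn_le_rayleigh_of_mem`; Mathlib `star_mulVec`, `dotProduct_mulVec` (adjoints).
-/

-- the mandated namespace `Summit.<Summit>.<Problem>.Theorems` repeats `HubbardSuperconductivity`
-- (single-problem summit, D-0017), which the `dupNamespace` linter flags on every declaration
set_option linter.dupNamespace false

noncomputable section

namespace Summit.HubbardSuperconductivity.HubbardSuperconductivity.Theorems.NoInfraredPileUp

open Literature.MathematicalPhysics.QuantumLattice Matrix Filter
open scoped ComplexConjugate ComplexOrder Topology

variable {n : Type*} [Fintype n]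

/-! ### Scalar-product bookkeeping -/

/-- A real scalar passes through `star` on vectors: `star (r • v) = r • star v`. [folklore] -/
theorem star_real_smul_vec (r : ℝ) (v : n → ℂ) : star ((r : ℂ) • v) = (r : ℂ) • star v := by
  rw [star_smul, Complex.star_def, Complex.conj_ofReal]

/-- `⟨v, v⟩` is the real number `Re⟨v, v⟩`, and it is nonnegative. [folklore] -/
theorem star_dotProduct_self_eq_re (v : n → ℂ) :
    star v ⬝ᵥ v = (((star v ⬝ᵥ v).re : ℝ) : ℂ) ∧ 0 ≤ (star v ⬝ᵥ v).re := by
  have h := Complex.nonneg_iff.1 (dotProduct_star_self_nonneg v)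
  refine ⟨Complex.ext (by simp) ?_, h.1⟩
  rw [Complex.ofReal_im]
  exact h.2.symm

/-! ### The variational inequality behind the bound -/

/-- From `2 s m₀ - s² m₁ ≤ C` for every real `s` (with `m₀, m₁ ≥ 0`) conclude `m₀² ≤ C m₁`:
optimise `s = m₀ / m₁`, or, when `m₁ = 0`, read off `m₀ = 0`. [folklore] -/
theorem sq_le_mul_of_forall_linear_quadratic {m₀ m₁ C : ℝ} (hm₀ : 0 ≤ m₀) (hm₁ : 0 ≤ m₁)
    (h : ∀ s : ℝ, 2 * s * m₀ - s ^ 2 * m₁ ≤ C) : m₀ ^ 2 ≤ C * m₁ := by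
  rcases hm₁.lt_or_eq with hm₁pos | hm₁0
  · have hs := h (m₀ / m₁)
    have hcalc : 2 * (m₀ / m₁) * m₀ - (m₀ / m₁) ^ 2 * m₁ = m₀ ^ 2 / m₁ := by
      field_simp
      ring
    rw [hcalc, div_le_iff₀ hm₁pos] at hs
    linarith
  · subst hm₁0
    rcases hm₀.lt_or_eq with hm₀pos | hm₀0
    · have hs := h ((C + 1) / (2 * m₀))
      have hcalc : 2 * ((C + 1) / (2 * m₀)) * m₀ - ((C + 1) / (2 * m₀)) ^ 2 * 0 = C + 1 := by
        field_simp
        ring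
      rw [hcalc] at hs
      linarith
    · rw [← hm₀0]; simp

/-! ### Feynman–Onsager from an energy floor -/

/-- **FEYNMAN–ONSAGER FROM AN ENERGY FLOOR** (registered stub `stub_fluctSqLeFloorMulFsum` of crux
stmt-HubbardSuperconductivity-18534; first lemma of the crux idea
`phonon-equipartition-compressibility`, signature verbatim from `SketchIdeator1.lean` §B).
Let `ψ` be a unit vector of an `H`- and `V`-invariant subspace `K` that is an eigenvector at the
sector energy `minEnergyOn H K`, with `⟨ψ,Vψ⟩ = 0` and `⟨Vψ, V² ψ⟩ = 0`. If the perturbed sector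
energy has the quadratic floor `E₀(H + hV) ≥ E₀(H) - C h²` for `|h| ≤ h₀`, then
`⟨Vψ,Vψ⟩² ≤ C · Re⟨Vψ, (H - E₀) Vψ⟩` — fluctuation² ≤ susceptibility-floor × f-sum. Proof: trial
vectors `ψ - s h • Vψ`, Rayleigh quotient `E₀ + h²(s² m₁ - 2 s m₀)/(1 + s²h²m₀)`, floor, `h → 0`,
optimise `s = m₀/m₁`. Feynman, Phys. Rev. 94 (1954) 262; Pitaevskii–Stringari, J. Low Temp. Phys.
85 (1991) 377 (moments `m₀² ≤ m₁ m₋₁`); Tasaki (2020) §2.2. [folklore] -/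
theorem stub_fluctSqLeFloorMulFsum :
    ∀ {n : Type*} [Fintype n] [DecidableEq n] (H V : Matrix n n ℂ), H.IsHermitian → V.IsHermitian →
      ∀ (K : Submodule ℂ (n → ℂ)), (∀ v ∈ K, H *ᵥ v ∈ K) → (∀ v ∈ K, V *ᵥ v ∈ K) →
      ∀ (ψ : n → ℂ), ψ ∈ K → star ψ ⬝ᵥ ψ = 1 → H *ᵥ ψ = ((H.minEnergyOn K : ℝ) : ℂ) • ψ →
      star ψ ⬝ᵥ (V *ᵥ ψ) = 0 → star (V *ᵥ ψ) ⬝ᵥ (V *ᵥ (V *ᵥ ψ)) = 0 →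
      ∀ (C h₀ : ℝ), 0 < h₀ →
      (∀ h : ℝ, |h| ≤ h₀ → H.minEnergyOn K - C * h ^ 2 ≤ (H + (h : ℂ) • V).minEnergyOn K) →
      ((star (V *ᵥ ψ) ⬝ᵥ (V *ᵥ ψ)).re) ^ 2 ≤
        C * (star (V *ᵥ ψ) ⬝ᵥ
          ((H - ((H.minEnergyOn K : ℝ) : ℂ) • (1 : Matrix n n ℂ)) *ᵥ (V *ᵥ ψ))).re := by
  intro n _ _ H V hH hV K hHK hVK ψ hψ h1 hev h0 h3 C h₀ hh₀ hfloor
  have _hHK := hHK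
  have hwK : V *ᵥ ψ ∈ K := hVK ψ hψ
  -- adjoint identities that need the vector `V ψ` literally
  have hψVw : star ψ ⬝ᵥ (V *ᵥ (V *ᵥ ψ)) = star (V *ᵥ ψ) ⬝ᵥ (V *ᵥ ψ) := by
    rw [star_mulVec, ← dotProduct_mulVec, hV.eq]
  have hψHw : star ψ ⬝ᵥ (H *ᵥ (V *ᵥ ψ)) = 0 := by
    have hsm : star ψ ᵥ* H = star (H *ᵥ ψ) := by rw [star_mulVec, hH.eq]
    rw [dotProduct_mulVec, hsm, hev, star_smul, Complex.star_def, Complex.conj_ofReal,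
      smul_dotProduct, h0, smul_zero]
  -- names: `w = Vψ`, `m₀ = ⟨w,w⟩`, `E₀`, `Q = ⟨w, H w⟩`
  generalize hw : V *ᵥ ψ = w at h0 h3 hwK hψVw hψHw ⊢
  obtain ⟨hPre, hm₀⟩ := star_dotProduct_self_eq_re w
  generalize hm₀def : (star w ⬝ᵥ w).re = m₀ at hPre hm₀ ⊢
  generalize hE₀ : H.minEnergyOn K = E₀ at hev hfloor ⊢
  -- the `f`-sum moment `m₁ = Re⟨w, (H - E₀) w⟩ = Re⟨w, H w⟩ - E₀ m₀`
  have hm₁ : (star w ⬝ᵥ ((H - (E₀ : ℂ) • (1 : Matrix n n ℂ)) *ᵥ w)).re =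
      (star w ⬝ᵥ (H *ᵥ w)).re - E₀ * m₀ := by
    rw [sub_mulVec, smul_mulVec, one_mulVec, dotProduct_sub, dotProduct_smul, smul_eq_mul,
      Complex.sub_re, Complex.re_ofReal_mul, hm₀def]
  rw [hm₁]
  generalize hQ : star w ⬝ᵥ (H *ᵥ w) = Q
  -- the remaining cross terms
  have hwψ : star w ⬝ᵥ ψ = 0 := by rw [star_dotProduct, h0, star_zero]
  have hψHψ : star ψ ⬝ᵥ (H *ᵥ ψ) = (E₀ : ℂ) := by
    rw [hev, dotProduct_smul, h1, smul_eq_mul, mul_one]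
  have hwHψ : star w ⬝ᵥ (H *ᵥ ψ) = 0 := by rw [hev, dotProduct_smul, hwψ, smul_zero]
  -- `m₁ ≥ 0`: the variational principle for `w ∈ K`
  have hm₁nn : 0 ≤ Q.re - E₀ * m₀ := by
    rcases hm₀.lt_or_eq with hpos | hzero
    · set c : ℝ := (Real.sqrt m₀)⁻¹ with hc
      have hc2 : c ^ 2 * m₀ = 1 := by
        rw [hc, inv_pow, Real.sq_sqrt hpos.le, inv_mul_cancel₀ hpos.ne']
      have hunit : star ((c : ℂ) • w) ⬝ᵥ ((c : ℂ) • w) = 1 := by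
        rw [star_real_smul_vec, smul_dotProduct, dotProduct_smul, smul_smul, smul_eq_mul, hPre]
        calc (c : ℂ) * c * (m₀ : ℂ) = ((c ^ 2 * m₀ : ℝ) : ℂ) := by push_cast; ring
          _ = 1 := by rw [hc2]; simp
      have hvar := minEnergyOn_le_rayleigh_of_mem hH K (K.smul_mem _ hwK) hunit
      rw [mulVec_smul, star_real_smul_vec, smul_dotProduct, dotProduct_smul, smul_smul,
        smul_eq_mul, hQ, hE₀] at hvar
      have hre : ((c : ℂ) * c * Q).re = c ^ 2 * Q.re := by
        rw [show (c : ℂ) * c = ((c ^ 2 : ℝ) : ℂ) by push_cast; ring, Complex.re_ofReal_mul]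
      rw [hre] at hvar
      have h' : E₀ ≤ c ^ 2 * Q.re := hvar
      have h'' : E₀ * m₀ ≤ c ^ 2 * Q.re * m₀ := mul_le_mul_of_nonneg_right h' hpos.le
      have h''' : c ^ 2 * Q.re * m₀ = Q.re := by
        rw [show c ^ 2 * Q.re * m₀ = c ^ 2 * m₀ * Q.re by ring, hc2, one_mul]
      linarith
    · have hw0 : w = 0 := by
        have h' : star w ⬝ᵥ w = 0 := by rw [hPre, ← hzero]; simp
        exact dotProduct_star_self_eq_zero.1 h'
      have hQ0 : Q = 0 := by rw [← hQ, hw0]; simp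
      rw [hQ0, ← hzero]
      simp
  -- KEY: for every `s` and every `h ∈ (0, h₀]`, `2 s m₀ - s² m₁ ≤ C (1 + s² h² m₀)`
  have key : ∀ s h : ℝ, 0 < h → h ≤ h₀ →
      2 * s * m₀ - s ^ 2 * (Q.re - E₀ * m₀) ≤ C * (1 + s ^ 2 * h ^ 2 * m₀) := by
    intro s h hh hhh
    -- the trial vector `ψ - (s h) • w ∈ K`
    have hφK : ψ - ((s * h : ℝ) : ℂ) • w ∈ K := K.sub_mem hψ (K.smul_mem _ hwK)
    -- its norm
    have hD : star (ψ - ((s * h : ℝ) : ℂ) • w) ⬝ᵥ (ψ - ((s * h : ℝ) : ℂ) • w) =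
        ((1 + (s * h) ^ 2 * m₀ : ℝ) : ℂ) := by
      rw [star_sub, star_real_smul_vec, sub_dotProduct, dotProduct_sub, dotProduct_sub,
        smul_dotProduct, smul_dotProduct, dotProduct_smul, dotProduct_smul, h1, h0, hwψ, hPre]
      simp only [smul_eq_mul, mul_zero, sub_zero]
      push_cast
      ring
    -- its energy for `H + h V`
    have hN : star (ψ - ((s * h : ℝ) : ℂ) • w) ⬝ᵥ
        ((H + (h : ℂ) • V) *ᵥ (ψ - ((s * h : ℝ) : ℂ) • w)) =
        (E₀ : ℂ) - 2 * ((s * h : ℝ) : ℂ) * (h : ℂ) * (m₀ : ℂ) + ((s * h : ℝ) : ℂ) ^ 2 * Q := by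
      rw [star_sub, star_real_smul_vec]
      simp only [add_mulVec, smul_mulVec, mulVec_sub, mulVec_smul, sub_dotProduct,
        dotProduct_sub, dotProduct_add, smul_dotProduct, dotProduct_smul, smul_eq_mul]
      rw [hw, hψHψ, h0, hψHw, hψVw, hwHψ, hQ, h3, hPre]
      ring
    -- normalise and apply the variational principle in the sector
    have hDpos : 0 < 1 + (s * h) ^ 2 * m₀ := by positivity
    set c : ℝ := (Real.sqrt (1 + (s * h) ^ 2 * m₀))⁻¹ with hc
    have hc2 : c ^ 2 * (1 + (s * h) ^ 2 * m₀) = 1 := by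
      rw [hc, inv_pow, Real.sq_sqrt hDpos.le, inv_mul_cancel₀ hDpos.ne']
    have hc2pos : 0 < c ^ 2 := by rw [hc]; positivity
    have hunit : star ((c : ℂ) • (ψ - ((s * h : ℝ) : ℂ) • w)) ⬝ᵥ
        ((c : ℂ) • (ψ - ((s * h : ℝ) : ℂ) • w)) = 1 := by
      rw [star_real_smul_vec, smul_dotProduct, dotProduct_smul, smul_smul, smul_eq_mul, hD]
      calc (c : ℂ) * c * ((1 + (s * h) ^ 2 * m₀ : ℝ) : ℂ)
          = ((c ^ 2 * (1 + (s * h) ^ 2 * m₀) : ℝ) : ℂ) := by push_cast; ring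
        _ = 1 := by rw [hc2]; simp
    have hHerm : (H + (h : ℂ) • V).IsHermitian := by
      have hV' : ((h : ℂ) • V).IsHermitian := by
        unfold Matrix.IsHermitian
        rw [conjTranspose_smul, hV.eq, Complex.star_def, Complex.conj_ofReal]
      exact hH.add hV'
    have hvar := minEnergyOn_le_rayleigh_of_mem hHerm K (K.smul_mem _ hφK) hunit
    rw [mulVec_smul, star_real_smul_vec, smul_dotProduct, dotProduct_smul, smul_smul, smul_eq_mul,
      hN] at hvar
    have hre : ((c : ℂ) * c * ((E₀ : ℂ) - 2 * ((s * h : ℝ) : ℂ) * (h : ℂ) * (m₀ : ℂ) +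
        ((s * h : ℝ) : ℂ) ^ 2 * Q)).re =
        c ^ 2 * (E₀ - 2 * (s * h) * h * m₀ + (s * h) ^ 2 * Q.re) := by
      have hcast : (c : ℂ) * c * ((E₀ : ℂ) - 2 * ((s * h : ℝ) : ℂ) * (h : ℂ) * (m₀ : ℂ) +
          ((s * h : ℝ) : ℂ) ^ 2 * Q) =
          ((c ^ 2 * (E₀ - 2 * (s * h) * h * m₀) : ℝ) : ℂ) + ((c ^ 2 * (s * h) ^ 2 : ℝ) : ℂ) * Q := by
        push_cast
        ring
      rw [hcast, Complex.add_re, Complex.ofReal_re, Complex.re_ofReal_mul]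
      ring
    rw [hre] at hvar
    -- the floor at `h`
    have hfl := hfloor h (by rw [abs_of_pos hh]; exact hhh)
    -- combine: `(E₀ - C h²)(1 + (sh)² m₀) ≤ E₀ - 2 (sh) h m₀ + (sh)² Re Q`
    have hcomb : (E₀ - C * h ^ 2) * (1 + (s * h) ^ 2 * m₀) ≤
        E₀ - 2 * (s * h) * h * m₀ + (s * h) ^ 2 * Q.re := by
      have h' : (E₀ - C * h ^ 2) * (c ^ 2 * (1 + (s * h) ^ 2 * m₀)) ≤
          c ^ 2 * (E₀ - 2 * (s * h) * h * m₀ + (s * h) ^ 2 * Q.re) := by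
        rw [hc2, mul_one]
        exact hfl.trans hvar
      rw [show (E₀ - C * h ^ 2) * (c ^ 2 * (1 + (s * h) ^ 2 * m₀)) =
          c ^ 2 * ((E₀ - C * h ^ 2) * (1 + (s * h) ^ 2 * m₀)) by ring] at h'
      exact le_of_mul_le_mul_left h' hc2pos
    -- divide by `h² > 0`
    have hh2 : 0 < h ^ 2 := by positivity
    have hid : h ^ 2 * (2 * s * m₀ - s ^ 2 * (Q.re - E₀ * m₀)) -
        h ^ 2 * (C * (1 + s ^ 2 * h ^ 2 * m₀)) =
        (E₀ - C * h ^ 2) * (1 + (s * h) ^ 2 * m₀) -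
          (E₀ - 2 * (s * h) * h * m₀ + (s * h) ^ 2 * Q.re) := by
      ring
    have hexp : h ^ 2 * (2 * s * m₀ - s ^ 2 * (Q.re - E₀ * m₀)) ≤
        h ^ 2 * (C * (1 + s ^ 2 * h ^ 2 * m₀)) := by
      linarith [hcomb, hid]
    exact le_of_mul_le_mul_left hexp hh2
  -- let `h → 0⁺` along `h₀ / (k + 1)`
  have hlim : ∀ s : ℝ, 2 * s * m₀ - s ^ 2 * (Q.re - E₀ * m₀) ≤ C := by
    intro s
    have hseq : Tendsto (fun k : ℕ => C * (1 + s ^ 2 * (h₀ * (1 / ((k : ℝ) + 1))) ^ 2 * m₀)) atTop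
        (𝓝 (C * (1 + s ^ 2 * (h₀ * 0) ^ 2 * m₀))) :=
      (((((tendsto_one_div_add_atTop_nhds_zero_nat.const_mul h₀).pow 2).const_mul
        (s ^ 2)).mul_const m₀).const_add 1).const_mul C
    rw [mul_zero, zero_pow two_ne_zero, mul_zero, zero_mul, add_zero, mul_one] at hseq
    refine ge_of_tendsto' hseq fun k => ?_
    have hk : (0 : ℝ) ≤ (k : ℝ) := Nat.cast_nonneg k
    refine key s (h₀ * (1 / ((k : ℝ) + 1))) (by positivity) ?_
    rw [mul_one_div]
    exact div_le_self hh₀.le (by linarith)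
  -- optimise in `s`
  exact sq_le_mul_of_forall_linear_quadratic hm₀ hm₁nn hlim

end Summit.HubbardSuperconductivity.HubbardSuperconductivity.Theorems.NoInfraredPileUp

end
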